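/-
Copyright: cell `langlands-arthur-audit` (papers/Langlands/langlands-arthur-audit), unit `pub-arthur-typer-g17`
(LEAN TYPER gen 17, 2026-08-19).  Staged for the tree under `Literature/NumberTheory/Automorphic/Arthur2013/Leaves/`
(LEAN-IN-TREE rule 2026-08-18); imports `Leaves.DescentLevis` (M55).  Module map: M60 (the packet id).
-/
import Literature.NumberTheory.Automorphic.Arthur2013.Leaves.DescentLevis

/-!
# Leaves · census of engine L (M55), II: the weighted data of `SO_8 ⋊ θ̃` with one `GL`-block, kernel-computed

Companion of `Leaves/DescentLevis` (M55; sources and readings there).  For `n = 4`, every row of TABLE 3 (M51) with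
exactly one `GL`-block (`GL_1 × SO_6 × GL_1`, `GL_2 × SO_4 × GL_2`, `GL_3 × SO_2 × GL_3`), every configuration and
every admissible tag choice (`860` tagged data; the two-block rows, `344` tagged data, are in part I,
`Leaves/DescentLevisCensus` = M58, the chunks exhaust the weighted rows by M54 `ODiagram.odRows_4_chunks`, and the rows
with `M̃ = G̃` carry `m = 0` and are not traversed): every tag choice is `good` (M55 `OTag.good`) and NO tag choice
consumes an essentially open identity — in the third case the first
essentially open identities occur at `n = 5` (M55 `levisO_capable_5`), in accordance with M54 (`predicate_countsO`:
no open-capable datum with `n ≤ 4`).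

What is NOT claimed: as in M55; nothing beyond `n = 4`.
-/

set_option autoImplicit false

namespace Literature.NumberTheory.Automorphic.Arthur2013.Leaves

open NonStd BasePoint ODiagram

namespace LeviSet

/-- **`n = 4`, Levi `GL_1 × SO_6 × GL_1`** (all `(Ñ′_1, Ñ′_2)`, `s_n`, configurations, tags): certified, nothing
essentially open. [folklore] (kernel evaluation) -/
theorem levisO4_gl1 : certifyO ((odRowsFor 4).filter (fun x => x.row.gl == [1])) = [] := by
  rw [show (odRowsFor 4).filter (fun x => x.row.gl == [1]) = odRowsWith 4 (fun r => r.gl == [1]) from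
      odRowsFor_filter_row 4 (fun r => r.gl == [1])]
  decide +kernel

/-- **`n = 4`, Levi `GL_2 × SO_4 × GL_2` or `GL_3 × SO_2 × GL_3`**: certified, nothing essentially open.
[folklore] (kernel evaluation) -/
theorem levisO4_gl23 : certifyO ((odRowsFor 4).filter (fun x => x.row.gl == [2] || x.row.gl == [3])) = [] := by
  rw [show (odRowsFor 4).filter (fun x => x.row.gl == [2] || x.row.gl == [3]) = odRowsWith 4 (fun r => r.gl == [2] || r.gl == [3]) from
      odRowsFor_filter_row 4 (fun r => r.gl == [2] || r.gl == [3])]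
  decide +kernel

/-- statement « census `n = 4`, one `GL`-block »: at every row of TABLE 3 (M51) with `n = 4` and one `GL`-block,
every configuration and every admissible tag choice is `good` and none is essentially open (`certifyO` returns
nothing); with `levisO4_blocks` of `Leaves/DescentLevisCensus` and `ODiagram.odRows_4_chunks` this covers every
`n = 4` datum with `M̃ ≠ G̃`. [folklore] (executable statement) -/
def CensusO4 : Prop :=
  certifyO ((odRowsFor 4).filter (fun x => x.row.gl == [1])) = [] ∧
    certifyO ((odRowsFor 4).filter (fun x => x.row.gl == [2] || x.row.gl == [3])) = []

/-- `CensusO4` holds, by `levisO4_gl1` and `levisO4_gl23`. [folklore] (kernel evaluation) -/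
theorem censusO4_holds : CensusO4 := ⟨levisO4_gl1, levisO4_gl23⟩

end LeviSet

end Literature.NumberTheory.Automorphic.Arthur2013.Leaves
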